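import Summits.BirchSwinnertonDyer.BirchSwinnertonDyer.Theorems.RamifiedSevenEllipticUnitsRigidityValuePairs
import Summits.BirchSwinnertonDyer.Rank1Residual.X12.O11.RamifiedRubinPackageReducedLineZp
import Literature.NumberTheory.QuadraticFields.ConjugateIdealClass
import HarnessLib

set_option linter.dupNamespace false
set_option autoImplicit false

/-!
# Rigidity bridge, COMPOSITION: from two `L`-pinned characters to the value-pair disjunction at
# cofinitely many places, and the registered stub H_Rig⁰ modulo the algebraic end

Helper file for the K7r Value crux `EllipticUnitValueSevenOfGZK` (stmt-BirchSwinnertonDyer-19945), line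
`rubin-formula-zp` v4.2 (`bd085e9ecccbb7e3`), registered stub H_Rig⁰ `stub_pinnedCharacterRigiditySeven :
∀ W ∈ 𝒞₇, X12.O11.RamifiedCMPinnedCharacterRigidityAtZp W 7` (planner D169 (a) / D171 (b): gaps
(G1)–(G3); line owner `bsd-cm-k7r-c4` g10). The analytic end of the bridge is in the tree (seat
k7r-c2 g7): (R1) `Rigidity.exists_heckeLFunction_eq_LSeries_translate`, (R2a)
`Rigidity.weightedCoeff_eq_of_heckeLFunction_eq`, (R2b, split primes)
`Rigidity.valuePair_eq_of_heckeLFunction_eq`. This file supplies: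

* §1 (G1) `Rigidity.value_eq_of_heckeLFunction_eq_of_inert` — the INERT sibling of (R2b): if the
  rational place `v` has a single place `w` of `K` above it, of residue degree `2`, and `φ`, `ψ` are
  unramified at `w`, then equal `L`-functions force `φ(ϖ_w) = ψ(ϖ_w)` (the coefficient at `n = ℓ²` is
  the single term `g(𝔭_w)`: Ribet §3, tree `finsum_absNorm_eq_prime_pow_of_singleton`).
* §2 the Galois bookkeeping of the places of a quadratic field `K` under its non-trivial automorphism
  `c`: `c • w` lies over the same rational place (`Ideal.under_smul`); in the split case the two places
  above `v` are `{w, c • w}` (transitivity of `Gal(K/ℚ)` on the primes above `v`, Mathlib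
  `Ideal.exists_smul_eq_of_isGaloisGroup`, and `Gal = {1, c}`); in the inert case `c • w = w`.
* §3 (G2) `Rigidity.valuePairs_eventually_of_heckeLFunction_eq` — for `[K:ℚ] = 2`, `c ≠ 1` and
  `heckeLFunction φ = heckeLFunction ψ` on a right half-plane: for all but finitely many places `w`
  (exceptions: `φ` or `ψ` ramified at `w` or at `c • w`, or `w` above a prime dividing `d_K`),
  `(φ(ϖ_w) = ψ(ϖ_w) ∧ φ(ϖ_{c•w}) = ψ(ϖ_{c•w})) ∨ (φ(ϖ_w) = ψ(ϖ_{c•w}) ∧ φ(ϖ_{c•w}) = ψ(ϖ_w))` —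
  VERBATIM the hypothesis `hpair` of the algebraic end `Rigidity.eq_or_eq_galConj_of_valuePairs`
  (seat k7r-c3 g12, interface frozen on STATUS 2026-08-27T08:04Z).
* §4 (G3 modulo the algebraic end) `pinnedCharacterRigidityAtZp_of_valuePairsRigidity` — the typed
  input `X12.O11.RamifiedCMPinnedCharacterRigidityAtZp W p` at EVERY prime `p`, from the algebraic end
  taken as a HYPOTHESIS in exactly its announced shape (imaginary quadratic `K`, `c ≠ 1`, `ψ` of
  infinity type `(1,0)`, `φ` arbitrary, `hpair` ⇒ `φ = ψ ∨ φ = ψ ∘ c`): the O11 frame supplies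
  `IsImaginaryQuadratic K`, and the two `L`-pinnings to `V` give `L(φ, s) = L(ψ, s)` on `re s > 3/2`.
  When the algebraic end lands, `stub_pinnedCharacterRigiditySeven` follows by one `exact` (separate
  file, so that this one does not wait).

HONEST FRAMING: kernel theorems only (no `def`, no named fact, no `sorry`); nothing about BSD is
claimed; the registered stub is NOT closed by this file (it is closed modulo the algebraic end, which
is displayed as a hypothesis, not asserted).

References: Neukirch, *Algebraic Number Theory*, I (8.2), (9.2), VII (8.1); Ribet, LNM 601 (1977) §3;
Marcus, *Number Fields*, Ch. 3 Thm. 25 / Ch. 4 (transitivity on primes).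
-/

noncomputable section

open scoped Classical Pointwise
open Filter NumberField IsDedekindDomain
  Literature.NumberTheory.GaloisRepresentations
  Literature.NumberTheory.LFunctions
  Literature.NumberTheory.EllipticCurves
  Literature.NumberTheory.EllipticCurves.ModularForms
  Literature.NumberTheory.QuadraticFields

namespace Summit.BirchSwinnertonDyer.BirchSwinnertonDyer.Theorems.RamifiedSevenEllipticUnits

namespace Rigidity

variable {K : Type} [Field K] [NumberField K]

/-! ## §1 (G1) The inert sibling of (R2b) -/

/-- **Equal Hecke `L`-functions ⇒ equal values at an inert prime.** `φ`, `ψ` Hecke characters of `K`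
with `heckeLFunction φ s = heckeLFunction ψ s` for `re s > s₀`; `v` a rational place with a SINGLE place
`w` of `K` above it, of residue degree `2` (`v` inert), `φ` and `ψ` unramified at `w`. Then
`φ(ϖ_w) = ψ(ϖ_w)`: the weighted coefficient identity of (R2a) at `n = ℓ²` reads `φ₀(w)·ℓ^{−2σ_φ} =
ψ₀(w)·ℓ^{−2σ_ψ}` because the only ideal of norm `ℓ²` is `𝔭_w` (`finsum_absNorm_eq_prime_pow_of_singleton`),
and `φ₀(w) = φ(w)·(Nw)^{σ_φ}` with `Nw = ℓ²`. [cite: Ribet1977Nebentypus, §3 Thm. (3.4) and Cor. (3.5)]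
[cite: NeukirchANT1999, Ch. VII §8 (8.1)] -/
theorem value_eq_of_heckeLFunction_eq_of_inert (φ ψ : HeckeCharacter K) (s₀ : ℝ)
    (h : ∀ s : ℂ, s₀ < s.re → heckeLFunction φ s = heckeLFunction ψ s)
    (v : HeightOneSpectrum (𝓞 ℚ)) {w : HeightOneSpectrum (𝓞 K)}
    (hS : {w : HeightOneSpectrum (𝓞 K) | w.asIdeal.under (𝓞 ℚ) = v.asIdeal} = {w})
    (hw : w.asIdeal.inertiaDeg (𝓞 ℚ) = 2)
    (hφ : φ.IsUnramifiedAt w) (hψ : ψ.IsUnramifiedAt w) :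
    φ.valueAtUniformizer w = ψ.valueAtUniformizer w := by
  obtain ⟨σ₁, φ₀, 𝔪₁, σ₂, ψ₀, 𝔪₂, -, h𝔪₁, -, hiff₁, -, hval₁, -, h𝔪₂, -, hiff₂, -, hval₂, hcoeff⟩ :=
    weightedCoeff_eq_of_heckeLFunction_eq φ ψ s₀ h
  set ℓ : ℕ := Rat.HeightOneSpectrum.natGenerator v with hℓ
  have hℓp : ℓ.Prime := Rat.HeightOneSpectrum.prime_natGenerator v
  set g₁ : Ideal (𝓞 K) →*₀ ℂ := rayClassCoeffHom 𝔪₁ fun v ↦ φ₀.valueAtUniformizer v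
  set g₂ : Ideal (𝓞 K) →*₀ ℂ := rayClassCoeffHom 𝔪₂ fun v ↦ ψ₀.valueAtUniformizer v
  have hmul : ∀ (g : Ideal (𝓞 K) →*₀ ℂ) (A B : Ideal (𝓞 K)), A ≠ ⊥ → B ≠ ⊥ → g (A * B) = g A * g B :=
    fun g A B _ _ ↦ map_mul g A B
  have hone : ∀ g : Ideal (𝓞 K) →*₀ ℂ, g ⊤ = 1 := fun g ↦ by rw [← Ideal.one_eq_top, map_one]
  -- the coefficient at `ℓ²` is the single term `g(𝔭_w)`
  have hsum : ∀ g : Ideal (𝓞 K) →*₀ ℂ, NumberField.twistCount K g (ℓ ^ 2) = g w.asIdeal := by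
    intro g
    have h1 := (finsum_absNorm_eq_prime_pow_of_singleton g (hmul g) (hone g) v hS hw 1).1
    rw [mul_one, pow_one] at h1
    rw [twistCount_eq_finsum, hℓ]
    exact h1
  have hg₁ : g₁ w.asIdeal = φ₀.valueAtUniformizer w :=
    rayClassCoeffHom_asIdeal _ ((hiff₁ w).mp hφ) h𝔪₁
  have hg₂ : g₂ w.asIdeal = ψ₀.valueAtUniformizer w :=
    rayClassCoeffHom_asIdeal _ ((hiff₂ w).mp hψ) h𝔪₂
  -- `N(𝔭_w) = ℓ²`
  have hm : w.asIdeal.under (𝓞 ℚ) = v.asIdeal := by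
    have : w ∈ {w : HeightOneSpectrum (𝓞 K) | w.asIdeal.under (𝓞 ℚ) = v.asIdeal} := by
      rw [hS]; exact Set.mem_singleton _
    exact this
  have hwv : w.under (𝓞 ℚ) = v :=
    HeightOneSpectrum.ext (by rw [HeightOneSpectrum.under_asIdeal]; exact hm)
  have hN : ((Ideal.absNorm w.asIdeal : ℕ) : ℂ) = ((ℓ ^ 2 : ℕ) : ℂ) := by
    rw [absNorm_asIdeal_eq_natGenerator_pow, hwv, hw]
  have hX : ((ℓ ^ 2 : ℕ) : ℂ) ≠ 0 := by exact_mod_cast pow_ne_zero 2 hℓp.ne_zero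
  have hXσ : ∀ σ : ℝ, ((ℓ ^ 2 : ℕ) : ℂ) ^ (σ : ℂ) * ((ℓ ^ 2 : ℕ) : ℂ) ^ (-(σ : ℂ)) = 1 := by
    intro σ
    rw [Complex.cpow_neg, mul_inv_cancel₀]
    exact fun h0 ↦ hX ((Complex.cpow_eq_zero_iff _ _).mp h0).1
  have e2 := hcoeff (ℓ ^ 2) (pow_ne_zero 2 hℓp.ne_zero)
  rw [hsum g₁, hsum g₂, hg₁, hg₂, hval₁, hval₂, hN, mul_assoc, hXσ, mul_one, mul_assoc, hXσ,
    mul_one] at e2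
  exact e2

/-! ## §2 Places of a quadratic field under its non-trivial automorphism -/

/-- `Gal(K/ℚ)` has two elements for a quadratic field. [folklore] -/
theorem card_algEquiv_eq_two (h2 : Module.finrank ℚ K = 2) : Nat.card (K ≃ₐ[ℚ] K) = 2 := by
  haveI : Algebra.IsQuadraticExtension ℚ K := ⟨h2⟩
  rw [IsGalois.card_aut_eq_finrank, h2]

/-- **`c • w` lies above the same rational place as `w`.** [cite: NeukirchANT1999, Ch. I §9 (conjugate primes)] -/
theorem under_smul_asIdeal (c : K ≃ₐ[ℚ] K) (w : HeightOneSpectrum (𝓞 K)) :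
    (c • w).asIdeal.under (𝓞 ℚ) = w.asIdeal.under (𝓞 ℚ) := by
  set v : HeightOneSpectrum (𝓞 ℚ) := w.under (𝓞 ℚ) with hv
  have hwv : w.asIdeal.under (𝓞 ℚ) = v.asIdeal := rfl
  have hℓw : ((Rat.HeightOneSpectrum.natGenerator v : ℕ) : 𝓞 K) ∈ w.asIdeal :=
    (asIdeal_under_eq_iff_natCast_mem v w).mp hwv
  rw [hwv]
  refine (asIdeal_under_eq_iff_natCast_mem v (c • w)).mpr ?_
  rw [Literature.NumberTheory.Automorphic.HeightOneSpectrum.smul_asIdeal,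
    Ideal.mem_pointwise_smul_iff_inv_smul_mem]
  have hfix : c⁻¹ • ((Rat.HeightOneSpectrum.natGenerator v : ℕ) : 𝓞 K) =
      ((Rat.HeightOneSpectrum.natGenerator v : ℕ) : 𝓞 K) :=
    map_natCast (MulSemiringAction.toRingHom (K ≃ₐ[ℚ] K) (𝓞 K) c⁻¹) _
  rw [hfix]
  exact hℓw

/-- **Split case: the two places above `v` are `w` and `c • w`.** In a quadratic field `K` with
non-trivial automorphism `c`, if the places above the rational place `v` are `{w₁, w₂}` with
`w₁ ≠ w₂`, then `c • w₁ = w₂` (`Gal(K/ℚ) = {1, c}` acts transitively on the primes above `v`).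
[cite: Marcus2018, Ch. 4 (before Thm. 29)] [cite: NeukirchANT1999, Ch. I §9 Prop. (9.1)] -/
theorem smul_eq_of_places_eq_pair (h2 : Module.finrank ℚ K = 2) (c : K ≃ₐ[ℚ] K) (hc : c ≠ 1)
    (v : HeightOneSpectrum (𝓞 ℚ)) {w₁ w₂ : HeightOneSpectrum (𝓞 K)} (hne : w₁ ≠ w₂)
    (hS : {w : HeightOneSpectrum (𝓞 K) | w.asIdeal.under (𝓞 ℚ) = v.asIdeal} = {w₁, w₂}) :
    c • w₁ = w₂ := by
  haveI : Algebra.IsQuadraticExtension ℚ K := ⟨h2⟩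
  haveI : IsGaloisGroup (K ≃ₐ[ℚ] K) (𝓞 ℚ) (𝓞 K) := IsGaloisGroup.of_isFractionRing _ _ _ ℚ K
  have hm₁ : w₁.asIdeal.under (𝓞 ℚ) = v.asIdeal := by
    have : w₁ ∈ {w : HeightOneSpectrum (𝓞 K) | w.asIdeal.under (𝓞 ℚ) = v.asIdeal} := by
      rw [hS]; exact Set.mem_insert _ _
    exact this
  have hm₂ : w₂.asIdeal.under (𝓞 ℚ) = v.asIdeal := by
    have : w₂ ∈ {w : HeightOneSpectrum (𝓞 K) | w.asIdeal.under (𝓞 ℚ) = v.asIdeal} := by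
      rw [hS]; exact Set.mem_insert_of_mem _ rfl
    exact this
  haveI := w₁.isPrime
  haveI := w₂.isPrime
  haveI : w₁.asIdeal.LiesOver v.asIdeal := ⟨hm₁.symm⟩
  haveI : w₂.asIdeal.LiesOver v.asIdeal := ⟨hm₂.symm⟩
  obtain ⟨σ, hσ⟩ :=
    Ideal.exists_smul_eq_of_isGaloisGroup v.asIdeal w₁.asIdeal w₂.asIdeal (K ≃ₐ[ℚ] K)
  rcases eq_one_or_eq_of_card_eq_two (card_algEquiv_eq_two h2) hc σ with rfl | rfl
  · exact absurd (HeightOneSpectrum.ext (by rw [one_smul] at hσ; exact hσ)) hne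
  · exact HeightOneSpectrum.ext hσ

/-- **Inert (or ramified) case: `c • w = w`** when `w` is the only place above `v`. [cite: NeukirchANT1999, Ch. I §9 Prop. (9.1)] -/
theorem smul_eq_self_of_places_eq_singleton (c : K ≃ₐ[ℚ] K) (v : HeightOneSpectrum (𝓞 ℚ))
    {w : HeightOneSpectrum (𝓞 K)}
    (hS : {w : HeightOneSpectrum (𝓞 K) | w.asIdeal.under (𝓞 ℚ) = v.asIdeal} = {w}) : c • w = w := by
  have hm : w.asIdeal.under (𝓞 ℚ) = v.asIdeal := by
    have : w ∈ {w : HeightOneSpectrum (𝓞 K) | w.asIdeal.under (𝓞 ℚ) = v.asIdeal} := by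
      rw [hS]; exact Set.mem_singleton _
    exact this
  have hcw : c • w ∈ {w : HeightOneSpectrum (𝓞 K) | w.asIdeal.under (𝓞 ℚ) = v.asIdeal} := by
    show (c • w).asIdeal.under (𝓞 ℚ) = v.asIdeal
    rw [under_smul_asIdeal, hm]
  rw [hS] at hcw
  simpa using hcw

/-! ## §3 (G2) The value-pair disjunction at cofinitely many places -/

/-- **Equal Hecke `L`-functions ⇒ the value-pair disjunction at all but finitely many places.** `K`
quadratic with non-trivial automorphism `c`; `φ`, `ψ` Hecke characters of `K` with
`heckeLFunction φ s = heckeLFunction ψ s` for `re s > s₀`. Then for all but finitely many finite places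
`w` of `K`: `(φ(ϖ_w) = ψ(ϖ_w) ∧ φ(ϖ_{c•w}) = ψ(ϖ_{c•w})) ∨ (φ(ϖ_w) = ψ(ϖ_{c•w}) ∧ φ(ϖ_{c•w}) = ψ(ϖ_w))`.
Exceptional places: `φ` or `ψ` ramified at `w` or at `c • w` (finitely many, `finite_ramifiedPlaces_holds`),
or `w` above a rational prime dividing `d_K` (finitely many, `Ideal.finite_factors`); at the others the
rational prime `ℓ` under `w` is unramified (`ramificationIdxIn_eq_one_of_not_dvd_discr`), so either
`ℓ` splits as `{w, c • w}` (§2) and (R2b) `valuePair_eq_of_heckeLFunction_eq` applies, or `ℓ` is inert,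
`c • w = w`, and §1 applies. This is VERBATIM the hypothesis `hpair` of the algebraic end of the
rigidity bridge. [cite: Ribet1977Nebentypus, §3 Thm. (3.4)] [cite: NeukirchANT1999, Ch. I Prop. (8.2), (9.2) and Ch. III §2 Cor. (2.12)] -/
theorem valuePairs_eventually_of_heckeLFunction_eq (h2 : Module.finrank ℚ K = 2)
    (c : K ≃ₐ[ℚ] K) (hc : c ≠ 1) (φ ψ : HeckeCharacter K) (s₀ : ℝ)
    (h : ∀ s : ℂ, s₀ < s.re → heckeLFunction φ s = heckeLFunction ψ s) :
    ∀ᶠ w : HeightOneSpectrum (𝓞 K) in Filter.cofinite,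
      (φ.valueAtUniformizer w = ψ.valueAtUniformizer w ∧
          φ.valueAtUniformizer (c • w) = ψ.valueAtUniformizer (c • w)) ∨
        (φ.valueAtUniformizer w = ψ.valueAtUniformizer (c • w) ∧
          φ.valueAtUniformizer (c • w) = ψ.valueAtUniformizer w) := by
  -- the finitely many exceptions
  have hφ : ∀ᶠ w : HeightOneSpectrum (𝓞 K) in cofinite, φ.IsUnramifiedAt w :=
    φ.finite_ramifiedPlaces_iff.1 (HeckeCharacter.finite_ramifiedPlaces_holds φ)
  have hψ : ∀ᶠ w : HeightOneSpectrum (𝓞 K) in cofinite, ψ.IsUnramifiedAt w :=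
    ψ.finite_ramifiedPlaces_iff.1 (HeckeCharacter.finite_ramifiedPlaces_holds ψ)
  have hinj : Function.Injective fun w : HeightOneSpectrum (𝓞 K) ↦ c • w := MulAction.injective c
  have hφc : ∀ᶠ w : HeightOneSpectrum (𝓞 K) in cofinite, φ.IsUnramifiedAt (c • w) :=
    hinj.tendsto_cofinite.eventually hφ
  have hψc : ∀ᶠ w : HeightOneSpectrum (𝓞 K) in cofinite, ψ.IsUnramifiedAt (c • w) :=
    hinj.tendsto_cofinite.eventually hψ
  set d : 𝓞 K := ((NumberField.discr K : ℤ) : 𝓞 K) with hd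
  have hd0 : d ≠ 0 := by
    rw [hd]
    exact_mod_cast NumberField.discr_ne_zero K
  have hD : ∀ᶠ w : HeightOneSpectrum (𝓞 K) in cofinite, d ∉ w.asIdeal := by
    have hfin : {w : HeightOneSpectrum (𝓞 K) | w.asIdeal ∣ Ideal.span {d}}.Finite :=
      Ideal.finite_factors ((Ideal.span_singleton_eq_bot.not).mpr hd0)
    refine Filter.eventually_cofinite.2 (hfin.subset fun w hw ↦ ?_)
    simp only [Set.mem_setOf_eq, not_not] at hw
    exact (Ideal.dvd_span_singleton).mpr hw
  filter_upwards [hφ, hψ, hφc, hψc, hD] with w hφw hψw hφcw hψcw hdw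
  -- the rational place under `w` is unramified in `K`
  set v : HeightOneSpectrum (𝓞 ℚ) := w.under (𝓞 ℚ) with hv
  have hwv : w.asIdeal.under (𝓞 ℚ) = v.asIdeal := rfl
  set ℓ : ℕ := Rat.HeightOneSpectrum.natGenerator v with hℓ
  have hℓp : ℓ.Prime := Rat.HeightOneSpectrum.prime_natGenerator v
  have hℓw : ((ℓ : ℕ) : 𝓞 K) ∈ w.asIdeal := (asIdeal_under_eq_iff_natCast_mem v w).mp hwv
  have hnd : ¬ (Rat.HeightOneSpectrum.natGenerator v : ℤ) ∣ NumberField.discr K := by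
    rintro ⟨k, hk⟩
    apply hdw
    have : d = ((ℓ : ℕ) : 𝓞 K) * ((k : ℤ) : 𝓞 K) := by
      rw [hd, hk]; push_cast; rfl
    rw [this]
    exact Ideal.mul_mem_right _ _ hℓw
  have he : v.asIdeal.ramificationIdxIn (𝓞 K) = 1 := ramificationIdxIn_eq_one_of_not_dvd_discr K v hnd
  rcases exists_places_eq_pair_or_eq_singleton h2 v he with
    ⟨w₁, w₂, hne, hS, h₁, h₂⟩ | ⟨w₀, hS, hw₀⟩
  · -- split: `w ∈ {w₁, w₂}` and `c • w` is the other place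
    have hwS : w ∈ {w' : HeightOneSpectrum (𝓞 K) | w'.asIdeal.under (𝓞 ℚ) = v.asIdeal} := hwv
    rw [hS] at hwS
    rcases hwS with rfl | rfl
    · have hcw : c • w = w₂ := smul_eq_of_places_eq_pair h2 c hc v hne hS
      rw [hcw] at hφcw hψcw ⊢
      exact valuePair_eq_of_heckeLFunction_eq φ ψ s₀ h v hne hS h₁ h₂ hφw hφcw hψw hψcw
    · -- here `w = w₂`
      have hS' : {w' : HeightOneSpectrum (𝓞 K) | w'.asIdeal.under (𝓞 ℚ) = v.asIdeal} = {w, w₁} := by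
        rw [hS, Set.pair_comm]
      have hcw : c • w = w₁ := smul_eq_of_places_eq_pair h2 c hc v hne.symm hS'
      rw [hcw] at hφcw hψcw ⊢
      exact valuePair_eq_of_heckeLFunction_eq φ ψ s₀ h v hne.symm hS' h₂ h₁ hφw hφcw hψw hψcw
  · -- inert: `w = w₀`, `c • w = w`, values agree
    have hwS : w ∈ {w' : HeightOneSpectrum (𝓞 K) | w'.asIdeal.under (𝓞 ℚ) = v.asIdeal} := hwv
    rw [hS, Set.mem_singleton_iff] at hwS
    subst hwS
    have hcw : c • w = w := smul_eq_self_of_places_eq_singleton c v hS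
    rw [hcw]
    have heq := value_eq_of_heckeLFunction_eq_of_inert φ ψ s₀ h v hS hw₀ hφw hψw
    exact Or.inl ⟨heq, heq⟩

end Rigidity

/-! ## §4 (G3 modulo the algebraic end) The typed input H_Rig⁰ at every prime -/

namespace PinnedRigidity

open Rigidity Summit.BirchSwinnertonDyer.Rank1Residual

/-- **H_Rig⁰ from the algebraic end of the rigidity bridge.** Granted the algebraic end in EXACTLY
its announced shape (seat k7r-c3, STATUS 2026-08-27T08:04Z: `K` imaginary quadratic, `c ≠ 1`, `ψ` of
infinity type `(1,0)`, `φ` arbitrary, the value-pair disjunction at cofinitely many places ⇒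
`φ = ψ ∨ φ = ψ ∘ c`) — displayed as the hypothesis `VPR`, not asserted — the typed input
`X12.O11.RamifiedCMPinnedCharacterRigidityAtZp W p` holds for EVERY `W` and `p`: an O11 frame
`IsFrame W p K 𝔭 W' C` makes `K` imaginary quadratic; `ψ` and `φ` are both `L`-pinned to `V`, so
`L(φ, s) = L(ψ, s)` on `re s > 3/2`, and §3 produces the value-pair disjunction. (The binders
`V.HasCM`, `cmFieldDiscrOfJ V.j = cmFieldDiscrOfJ W.j` and `IsHeckeConjEquivariant cK ψ` of the `Prop`
are not needed.) [cite: NeukirchANT1999, Ch. VII §8 (8.1)] [cite: SilvermanATAEC1994, Ch. II Thm. 10.5 (the character pinned by `L(E/ℚ, s) = L(ψ, s)`; shape only)] -/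
theorem pinnedCharacterRigidityAtZp_of_valuePairsRigidity
    (VPR : ∀ (K : Type) [Field K] [NumberField K], IsImaginaryQuadratic K →
      ∀ (c : K ≃ₐ[ℚ] K), c ≠ 1 → ∀ (φ ψ : HeckeCharacter K),
        ψ.HasInfinityType (fun _ ↦ 1) (fun _ ↦ 0) →
        (∀ᶠ w : HeightOneSpectrum (𝓞 K) in Filter.cofinite,
          (φ.valueAtUniformizer w = ψ.valueAtUniformizer w ∧
              φ.valueAtUniformizer (c • w) = ψ.valueAtUniformizer (c • w)) ∨
            (φ.valueAtUniformizer w = ψ.valueAtUniformizer (c • w) ∧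
              φ.valueAtUniformizer (c • w) = ψ.valueAtUniformizer w)) →
        φ = ψ ∨ φ = HeckeCharacter.galConj c ψ)
    (W : WeierstrassCurve ℚ) [W.IsElliptic] [W.IsGloballyMinimal] (p : ℕ) [Fact p.Prime] :
    X12.O11.RamifiedCMPinnedCharacterRigidityAtZp W p := by
  intro K _ _ 𝔭 W' _ _ C hF V _ _ _ cK hcK ψ φ hinf _ hLψ hLφ
  obtain ⟨-, -, -, hK, -, -, -⟩ := hF
  have hL : ∀ s : ℂ, (3 / 2 : ℝ) < s.re → heckeLFunction φ s = heckeLFunction ψ s := by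
    intro s hs
    have hs' : 3 / 2 < s.re := by exact_mod_cast hs
    rw [hLφ s hs', hLψ s hs']
  exact VPR K hK cK hcK φ ψ hinf
    (valuePairs_eventually_of_heckeLFunction_eq hK.1 cK hcK φ ψ (3 / 2) hL)

end PinnedRigidity

end Summit.BirchSwinnertonDyer.BirchSwinnertonDyer.Theorems.RamifiedSevenEllipticUnits

end
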